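import Literature.AlgebraicGeometry.Motives.SpecialisedHypersurfaceFamily
import Literature.AlgebraicGeometry.Motives.UniversalHypersurfaceQuasiProjective
import Literature.AlgebraicGeometry.HodgeTheory.MotivatedClassesDeformationInputs
import Literature.AlgebraicGeometry.HodgeTheory.DirectImageBaseChangeSections
import Literature.AlgebraicGeometry.HodgeTheory.QuasiProjectiveOfAffine
import HarnessLib

/-!
# The specialised family of smooth hypersurfaces: points in coordinates, the base, quasi-projectivity,
# Ehresmann local triviality

Family `hodge`, layer `Literature/AlgebraicGeometry/HodgeTheory`; theorems and two auxiliary definitions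
(the coefficient homomorphism of a point, as a ring map and as a `k`-algebra map), no named fact.
Companion of `Motives/SpecialisedHypersurfaceFamily` (prover seat `hodge-nonav-prover-Ax`, route
`CyclicUnitaryPowers`, crux K1 stmt-HodgeConjecture-19544): for a coefficient specialisation
`φ : k[a_m | |m| = d] →ₐ[k] k[b_i | i ∈ ι]` the family `familySpz k n d φ : totalSpz ⟶ baseSpz` of smooth
hypersurfaces of degree `d` in `ℙⁿ⁺¹` parametrised through `φ`, its base `S_φ` (open in `𝔸^ι`) and the
point `pointOfFormSpz` of a nonsingular form of the sub-family. Pattern of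
`MonomialSupportedHypersurfaceFamily{,Points}` (the linear case `φ = killHom M`).

## Contents

* §1 (any field): the coefficient homomorphism `pointHomSpz t : k[b] → K` of a `K`-point (`ψ_t` as a
  `k`-algebra map: `pointAlgHomSpz`), the form `pointFormSpz t = Σ_m t(φ a_m) x^m` of a point
  (`coeff_pointFormSpz`, `pointAlgHomSpz_comp`), **every `k`-point is the point of its form**
  (`pointOfFormSpz_pointFormSpz`), points are determined by their coefficient homomorphism
  (`pointHomSpz_injective`, `pointHomSpz_pointOfFormSpz`, `pointFormSpz_pointOfFormSpz`); the
  underlying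
  point of `𝔸^ι` is the kernel of `ψ_t` (`ι_baseSpz_pt_eq_comap`), so **a set `W ⊆ S_φ(k)` which is Zariski
  closed on points is cut out, on the points `[G]_ψ`, by polynomials in the coordinates `b`**
  (`exists_polynomials_baseSpz`).
* §2 (any field, `ι` finite): `S_φ → Spec k` is smooth (`smooth_baseSpz_hom`), separated, locally of finite
  type, irreducible as soon as non-empty (`irreducibleSpace_baseSpz_left`).
* §3 (`k = ℂ`): `S_φ` and the total space `𝒴_φ` are quasi-projective over `ℂ`
  (`isQuasiProjectiveOver_baseSpz`: open in affine space; `isQuasiProjectiveOver_totalSpz`: closed in the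
  quasi-projective `𝒴_U`, `isQuasiProjectiveOver_total`), and **`Rᵏ(π_φ)_*` is a local system on all of
  `S_φ(ℂ)`** (`isCohomologicallyLocallyTrivialOn_familySpz`, Ehresmann over the smooth base).

## References

* C. Voisin, *Hodge Theory and Complex Algebraic Geometry II* (2003), §6.2.1. [VoisinHodgeII2003]
* C. Voisin, *Hodge Theory and Complex Algebraic Geometry I* (2002), Thm. 9.3, §9.2.1 (Ehresmann, the local
  systems `Rᵏπ_*A`). [VoisinHodgeI2002]
* J. A. Carlson, D. Toledo, Duke Math. J. 97 (1999), §2 (genericity in the space of forms). [CarlsonToledo1999]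
* R. Hartshorne, *Algebraic Geometry* (1977), I Ex. 5.8, II §4, Ex. 3.11, III §10. [Hartshorne1977]
-/

noncomputable section

open CategoryTheory AlgebraicGeometry MvPolynomial Limits
open Literature.AlgebraicGeometry.Motives
open Literature.AlgebraicGeometry.Motives.UniversalHypersurface

universe u

namespace Literature.AlgebraicGeometry.HodgeTheory.UniversalHypersurface

/-! ### §1 The points of `S_φ` and their forms -/

section Points

variable (k : Type u) [Field k] (n d : ℕ) {ι : Type} (φ : CoeffRing k n d →ₐ[k] MvPolynomial ι k)
  {K : Type u} [Field K] [Algebra k K]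

/-- The **coefficient homomorphism** `k[b] → K` of a `K`-point `t` of `S_φ` (`Spec K → S_φ ⊆ 𝔸^ι`, Mathlib
`Spec.preimage`). [cite: VoisinHodgeII2003, §6.2.1] -/
def pointHomSpz (t : AlgPoints (baseSpz k n d φ) K) : CommRingCat.of (MvPolynomial ι k) ⟶ CommRingCat.of K :=
  Spec.preimage (t.left ≫ (baseSpzOpens k n d φ).ι)

/-- `Spec (pointHomSpz t)` is the point `t` followed by `S_φ ⊆ 𝔸^ι`. [cite: VoisinHodgeII2003, §6.2.1] -/
theorem Spec_map_pointHomSpz (t : AlgPoints (baseSpz k n d φ) K) :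
    Spec.map (pointHomSpz k n d φ t) = t.left ≫ (baseSpzOpens k n d φ).ι :=
  Spec.map_preimage _

/-- The coefficient homomorphism of a point of `S_φ` is a `k`-algebra map. [cite: VoisinHodgeII2003, §6.2.1] -/
theorem pointHomSpz_comp_algebraMap (t : AlgPoints (baseSpz k n d φ) K) :
    (pointHomSpz k n d φ t).hom.comp (algebraMap k (MvPolynomial ι k)) = algebraMap k K := by
  have hw : Spec.map (pointHomSpz k n d φ t) ≫ specSpzToSpec k (ι := ι) =
      Spec.map (CommRingCat.ofHom (algebraMap k K)) := by
    rw [reassoc_of% (Spec_map_pointHomSpz k n d φ t)]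
    exact Over.w t
  rw [← Spec.map_comp] at hw
  have := congrArg CommRingCat.Hom.hom (Spec.map_injective hw)
  simpa using this

/-- The coefficient homomorphism of a point of `S_φ` as a `k`-algebra map `ψ_t : k[b] →ₐ[k] K`.
[cite: VoisinHodgeII2003, §6.2.1] -/
def pointAlgHomSpz (t : AlgPoints (baseSpz k n d φ) K) : MvPolynomial ι k →ₐ[k] K :=
  { (pointHomSpz k n d φ t).hom with
    commutes' := fun r => by
      have h := congrArg (fun χ : k →+* K => χ r) (pointHomSpz_comp_algebraMap k n d φ t)
      simp only [RingHom.comp_apply] at h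
      exact h }

/-- `ψ_t` and `pointHomSpz t` are the same map. [cite: VoisinHodgeII2003, §6.2.1] -/
@[simp]
theorem pointAlgHomSpz_apply (t : AlgPoints (baseSpz k n d φ) K) (F : MvPolynomial ι k) :
    pointAlgHomSpz k n d φ t F = (pointHomSpz k n d φ t).hom F := rfl

/-- `ψ_t.toRingHom = pointHomSpz t`. [cite: VoisinHodgeII2003, §6.2.1] -/
theorem pointAlgHomSpz_toRingHom (t : AlgPoints (baseSpz k n d φ) K) :
    (pointAlgHomSpz k n d φ t).toRingHom = (pointHomSpz k n d φ t).hom :=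
  RingHom.ext fun _ => rfl

/-- **The coefficient homomorphism of the image point in `U` factors through `φ`**:
`pointHom (toBaseSpz t) = pointHomSpz t ∘ φ` — the form of `t` read in `S^d` has the coefficients
`t(φ a_m)`. [cite: VoisinHodgeII2003, §6.2.1] -/
theorem pointHom_map_toBaseSpz (t : AlgPoints (baseSpz k n d φ) K) :
    pointHom k n d (AlgPoints.map (toBaseSpz k n d φ) t) =
      CommRingCat.ofHom φ.toRingHom ≫ pointHomSpz k n d φ t := by
  apply Spec.map_injective
  rw [Spec.map_comp, Spec_map_pointHomSpz, Spec_map_pointHom]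
  calc (AlgPoints.map (toBaseSpz k n d φ) t).left ≫ (baseOpens k n d).ι
      = (t.left ≫ (toBaseSpz k n d φ).left) ≫ (baseOpens k n d).ι := rfl
    _ = t.left ≫ ((toBaseSpz k n d φ).left ≫ (baseOpens k n d).ι) := Category.assoc _ _ _
    _ = t.left ≫ ((baseSpzOpens k n d φ).ι ≫ specSpz k n d φ) := whisker_eq _ (toBaseSpz_left_comp_ι k n d φ)
    _ = (t.left ≫ (baseSpzOpens k n d φ).ι) ≫ specSpz k n d φ := (Category.assoc _ _ _).symm

/-- **The form `F_t ∈ K[x₀, …, x_{n+1}]` of a `K`-point `t` of `S_φ`**: the form of its image in `U`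
(`pointForm`), i.e. `Σ_m t(φ a_m) x^m`. An `abbrev`, so that `isHomogeneous_pointForm`,
`isNonsingularForm_pointForm`, `coeff_pointForm` apply verbatim. [cite: VoisinHodgeII2003, §6.2.1] -/
abbrev pointFormSpz (t : AlgPoints (baseSpz k n d φ) K) : MvPolynomial (Fin (n + 2)) K :=
  pointForm k n d (AlgPoints.map (toBaseSpz k n d φ) t)

/-- The coefficients of the form of a point of `S_φ`: `coeff_m F_t = t(φ a_m)`. [cite: VoisinHodgeII2003, §6.2.1] -/
theorem coeff_pointFormSpz (t : AlgPoints (baseSpz k n d φ) K) (m : DegIndex n d) :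
    coeff m.1 (pointFormSpz k n d φ t) = (pointHomSpz k n d φ t).hom (φ (X m)) := by
  rw [coeff_pointForm, pointHom_map_toBaseSpz, CommRingCat.hom_comp, CommRingCat.hom_ofHom,
    RingHom.comp_apply, AlgHom.toRingHom_eq_coe, AlgHom.coe_toRingHom]

/-- **The coefficient vector of the form of a point factors through `φ`**: `ψ_t ∘ φ = coeffHom F_t`.
[cite: VoisinHodgeII2003, §6.2.1] -/
theorem pointAlgHomSpz_comp (t : AlgPoints (baseSpz k n d φ) k) :
    (pointAlgHomSpz k n d φ t).comp φ = coeffHom k n d (pointFormSpz k n d φ t) := by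
  refine MvPolynomial.algHom_ext fun m => ?_
  rw [AlgHom.comp_apply, aeval_X, coeff_pointFormSpz]
  rfl

/-- The coefficient homomorphism of the point `[F_t]_{ψ_t}` built from the form of `t` is that of `t`.
[cite: VoisinHodgeII2003, §6.2.1] -/
theorem ofHom_pointAlgHomSpz (t : AlgPoints (baseSpz k n d φ) K) :
    CommRingCat.ofHom (pointAlgHomSpz k n d φ t).toRingHom = pointHomSpz k n d φ t := by
  ext1
  rw [CommRingCat.hom_ofHom, pointAlgHomSpz_toRingHom]

/-- **Every `k`-point of `S_φ` is the point `[F_t]_{ψ_t}` of its form** (`S_φ ⊆ 𝔸^ι` is a monomorphism and both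
have coefficient homomorphism `pointHomSpz t`). [cite: VoisinHodgeII2003, §6.2.1] -/
theorem pointOfFormSpz_pointFormSpz (t : AlgPoints (baseSpz k n d φ) k) :
    pointOfFormSpz k n d φ (isHomogeneous_pointForm k n d _) (isNonsingularForm_pointForm k n d _)
      (pointAlgHomSpz_comp k n d φ t) = t := by
  have e1 := pointOfFormSpz_left_comp_ι k n d φ (isHomogeneous_pointForm k n d _)
    (isNonsingularForm_pointForm k n d _) (pointAlgHomSpz_comp k n d φ t)
  rw [ofHom_pointAlgHomSpz, Spec_map_pointHomSpz] at e1
  exact Over.OverMorphism.ext ((cancel_mono (baseSpzOpens k n d φ).ι).mp e1)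

/-- **A `k`-point of `S_φ` is determined by its coefficient homomorphism** (`S_φ ⊆ 𝔸^ι` is a monomorphism
and `Spec` is faithful). [cite: VoisinHodgeII2003, §6.2.1] -/
theorem pointHomSpz_injective : Function.Injective (pointHomSpz k n d φ (K := K)) := by
  intro s t h
  have h1 : s.left ≫ (baseSpzOpens k n d φ).ι = t.left ≫ (baseSpzOpens k n d φ).ι := by
    rw [← Spec_map_pointHomSpz, ← Spec_map_pointHomSpz, h]
  exact Over.OverMorphism.ext ((cancel_mono (baseSpzOpens k n d φ).ι).mp h1)

/-- The coefficient homomorphism of the point `[G]_ψ` is `ψ`. [cite: VoisinHodgeII2003, §6.2.1] -/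
theorem pointHomSpz_pointOfFormSpz {G : MvPolynomial (Fin (n + 2)) k} (hG : G.IsHomogeneous d)
    (hJ : SmoothHypersurface.IsNonsingularForm k G) {ψ : MvPolynomial ι k →ₐ[k] k}
    (hψ : ψ.comp φ = coeffHom k n d G) :
    pointHomSpz k n d φ (pointOfFormSpz k n d φ hG hJ hψ) = CommRingCat.ofHom ψ.toRingHom := by
  apply Spec.map_injective
  rw [Spec_map_pointHomSpz]
  exact pointOfFormSpz_left_comp_ι k n d φ hG hJ hψ

/-- **The form of the point `[G]_ψ` is `G`** (for `G` nonsingular, homogeneous of degree `d`, in the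
sub-family). [cite: VoisinHodgeII2003, §6.2.1] -/
theorem pointFormSpz_pointOfFormSpz {G : MvPolynomial (Fin (n + 2)) k} (hG : G.IsHomogeneous d)
    (hJ : SmoothHypersurface.IsNonsingularForm k G) {ψ : MvPolynomial ι k →ₐ[k] k}
    (hψ : ψ.comp φ = coeffHom k n d G) :
    pointFormSpz k n d φ (pointOfFormSpz k n d φ hG hJ hψ) = G := by
  rw [pointFormSpz, map_toBaseSpz_pointOfFormSpz, pointForm_pointOfForm]

/-- Two points `[G]_ψ`, `[G']_{ψ'}` with the same coefficient homomorphism `ψ = ψ'` coincide.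
[cite: VoisinHodgeII2003, §6.2.1] -/
theorem pointOfFormSpz_eq_of_eq {G G' : MvPolynomial (Fin (n + 2)) k} (hG : G.IsHomogeneous d)
    (hJ : SmoothHypersurface.IsNonsingularForm k G) (hG' : G'.IsHomogeneous d)
    (hJ' : SmoothHypersurface.IsNonsingularForm k G') {ψ ψ' : MvPolynomial ι k →ₐ[k] k}
    (hψ : ψ.comp φ = coeffHom k n d G) (hψ' : ψ'.comp φ = coeffHom k n d G') (h : ψ = ψ') :
    pointOfFormSpz k n d φ hG hJ hψ = pointOfFormSpz k n d φ hG' hJ' hψ' := by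
  apply pointHomSpz_injective k n d φ
  rw [pointHomSpz_pointOfFormSpz, pointHomSpz_pointOfFormSpz, h]

/-- The hypersurface of the form of any `K`-point of `S_φ` is a smooth projective `n`-fold (`n ≥ 1`, `d ≥ 1`).
[cite: VoisinHodgeII2003, §6.2.1] -/
theorem isSmoothProjective_hypersurface_pointFormSpz (hn : 1 ≤ n) (hd : 1 ≤ d)
    (t : AlgPoints (baseSpz k n d φ) K) :
    IsSmoothProjective n (SmoothHypersurface.hypersurface (pointFormSpz k n d φ t)) :=
  isSmoothProjective_hypersurface_pointForm k n d hn hd _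

end Points

/-! ### §1b Rational points of `S_φ` in the coordinates `b` -/

section CoeffVector

variable (k : Type u) [Field k] (n d : ℕ) {ι : Type} (φ : CoeffRing k n d →ₐ[k] MvPolynomial ι k)

/-- The coefficient homomorphism of a `k`-point of `S_φ` is evaluation at its coordinate vector
`i ↦ t(b_i)`. [cite: VoisinHodgeII2003, §6.2.1] -/
theorem pointHomSpz_hom_eq_eval (t : AlgPoints (baseSpz k n d φ) k) :
    (pointHomSpz k n d φ t).hom = eval (fun i => (pointHomSpz k n d φ t).hom (X i)) := by
  refine MvPolynomial.ringHom_ext (fun r => ?_) (fun i => ?_)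
  · have h := congrArg (fun χ : k →+* k => χ r) (pointHomSpz_comp_algebraMap k n d φ t)
    simp only [RingHom.comp_apply, Algebra.algebraMap_self, RingHom.id_apply] at h
    rw [MvPolynomial.algebraMap_eq] at h
    rw [h, eval_C]
  · rw [eval_X]

/-- **The point of `𝔸^ι` under a `k`-point `t` of `S_φ`** is the contraction of the closed point of `Spec k`
along the coefficient homomorphism (`Spec_map_pointHomSpz`). [cite: VoisinHodgeII2003, §6.2.1] -/
theorem ι_baseSpz_pt_eq_comap (t : AlgPoints (baseSpz k n d φ) k) :
    (baseSpzOpens k n d φ).ι.base t.pt =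
      PrimeSpectrum.comap (pointHomSpz k n d φ t).hom (IsLocalRing.closedPoint k) := by
  show (t.left ≫ (baseSpzOpens k n d φ).ι).base (IsLocalRing.closedPoint k) = _
  rw [← Spec_map_pointHomSpz]
  rfl

/-- For a ring homomorphism `χ : R → k` to a field, the contraction of the closed point lies on `V(S)` iff
`χ` kills `S`. [folklore] -/
private theorem comap_closedPoint_mem_zeroLocus_iff' {R : Type u} [CommRing R] (χ : R →+* k) (S : Set R) :
    PrimeSpectrum.comap χ (IsLocalRing.closedPoint k) ∈ PrimeSpectrum.zeroLocus S ↔ ∀ F ∈ S, χ F = 0 := by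
  rw [PrimeSpectrum.mem_zeroLocus]
  refine forall₂_congr fun F _ => ?_
  change χ F ∈ IsLocalRing.maximalIdeal k ↔ _
  rw [IsLocalRing.mem_maximalIdeal, mem_nonunits_iff, isUnit_iff_ne_zero, not_not]

/-- **A `k`-point `t ∈ S_φ(k)` lies over the Zariski closed set `V(S) ⊆ 𝔸^ι` iff every member of `S` is
killed by its coefficient homomorphism.** [cite: VoisinHodgeII2003, §6.2.1] -/
theorem ι_baseSpz_pt_mem_zeroLocus_iff (t : AlgPoints (baseSpz k n d φ) k) (S : Set (MvPolynomial ι k)) :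
    (baseSpzOpens k n d φ).ι.base t.pt ∈ PrimeSpectrum.zeroLocus S ↔
      ∀ F ∈ S, (pointHomSpz k n d φ t).hom F = 0 := by
  rw [ι_baseSpz_pt_eq_comap]
  exact comap_closedPoint_mem_zeroLocus_iff' k (pointHomSpz k n d φ t).hom S

/-- **A subset of `S_φ(k)` which is Zariski closed on points is cut out by polynomials in the coordinates**:
`W = {t | F(t(b)) = 0 ∀ F ∈ S}` for some `S ⊆ k[b]` (`S_φ ⊆ 𝔸^ι` is a topological embedding and closed
subsets of `𝔸^ι` are the `V(S)`). [cite: VoisinHodgeII2003, §6.2.1] -/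
theorem exists_forall_mem_iff_of_isZariskiClosedOnPoints_baseSpz (W : Set (AlgPoints (baseSpz k n d φ) k))
    (hW : IsZariskiClosedOnPoints (baseSpz k n d φ) W) :
    ∃ S : Set (MvPolynomial ι k), ∀ t : AlgPoints (baseSpz k n d φ) k,
      t ∈ W ↔ ∀ F ∈ S, (pointHomSpz k n d φ t).hom F = 0 := by
  obtain ⟨Zc, hZc, rfl⟩ := hW
  have hind : Topology.IsInducing (baseSpzOpens k n d φ).ι.base :=
    (baseSpzOpens k n d φ).ι.isOpenEmbedding.isInducing
  obtain ⟨Cl, hCl, hZcCl⟩ := hind.isClosed_iff.mp hZc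
  obtain ⟨S, rfl⟩ := (PrimeSpectrum.isClosed_iff_zeroLocus Cl).mp hCl
  refine ⟨S, fun t => ?_⟩
  have h1 : t ∈ {P : AlgPoints (baseSpz k n d φ) k | P.pt ∈ Zc} ↔
      (baseSpzOpens k n d φ).ι.base t.pt ∈ PrimeSpectrum.zeroLocus S := by
    rw [← hZcCl]
    rfl
  rw [h1, ι_baseSpz_pt_mem_zeroLocus_iff]

/-- **Zariski-closed subsets of `S_φ(k)` are cut out, on the classified forms `[G]_ψ`, by polynomials in the
coordinates `b` evaluated through `ψ`** (the clause `exists_polynomials` of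
`CyclicCoverReflectionMonodromy.CarlsonToledoFamily` in the specialised setting). [cite: CarlsonToledo1999, §2] -/
theorem exists_polynomials_baseSpz (W : Set (AlgPoints (baseSpz k n d φ) k))
    (hW : IsZariskiClosedOnPoints (baseSpz k n d φ) W) :
    ∃ 𝒢 : Set (MvPolynomial ι k), ∀ (G : MvPolynomial (Fin (n + 2)) k) (hG : G.IsHomogeneous d)
      (hJ : SmoothHypersurface.IsNonsingularForm k G) (ψ : MvPolynomial ι k →ₐ[k] k)
      (hψ : ψ.comp φ = coeffHom k n d G),
      pointOfFormSpz k n d φ hG hJ hψ ∈ W ↔ ∀ g ∈ 𝒢, ψ g = 0 := by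
  obtain ⟨S, hS⟩ := exists_forall_mem_iff_of_isZariskiClosedOnPoints_baseSpz k n d φ W hW
  refine ⟨S, fun G hG hJ ψ hψ => ?_⟩
  rw [hS, pointHomSpz_pointOfFormSpz k n d φ hG hJ hψ, CommRingCat.hom_ofHom]
  rfl

end CoeffVector

/-! ### §2 The base `S_φ`: an open subscheme of affine space -/

section Base

variable (k : Type u) [Field k] (n d : ℕ) {ι : Type} [Finite ι] (φ : CoeffRing k n d →ₐ[k] MvPolynomial ι k)

omit [Finite ι] in
/-- `S_φ ⟶ 𝔸^ι` is an open immersion (`rfl`-level: it is `Scheme.Opens.ι`). [cite: Hartshorne1977, II Ex.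
2.2 (open subschemes)] -/
theorem isOpenImmersion_baseSpzOpens_ι : IsOpenImmersion (baseSpzOpens k n d φ).ι := inferInstance

omit [Finite ι] in
/-- `k[b_i | i ∈ ι]` is standard smooth over `k` of relative dimension `#ι` (a polynomial ring in finitely
many variables; Hartshorne III §10 Example 10.0.1). [cite: Hartshorne1977, III §10 Example 10.0.1] -/
theorem isStandardSmoothOfRelativeDimension_mvPolynomial [Finite ι] :
    Algebra.IsStandardSmoothOfRelativeDimension (Nat.card ι) k (MvPolynomial ι k) := by
  haveI : Fintype ι := Fintype.ofFinite ι
  rw [Nat.card_eq_fintype_card]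
  haveI := ProjectiveSpace.isStandardSmoothOfRelativeDimension_mvPolynomial_fin k (Fintype.card ι)
  exact Algebra.IsStandardSmoothOfRelativeDimension.of_algEquiv (Fintype.card ι)
    (MvPolynomial.renameEquiv k (Fintype.equivFin ι).symm)

/-- `𝔸^ι = Spec k[b] → Spec k` is smooth of relative dimension `#ι`. [cite: Hartshorne1977, III §10 Example 10.0.1] -/
theorem smoothOfRelativeDimension_specSpzToSpec :
    SmoothOfRelativeDimension (Nat.card ι) (specSpzToSpec k (ι := ι)) := by
  rw [HasRingHomProperty.Spec_iff (P := @SmoothOfRelativeDimension (Nat.card ι)), CommRingCat.hom_ofHom]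
  refine RingHom.locally_of RingHom.isStandardSmoothOfRelativeDimension_respectsIso _ ?_
  rw [RingHom.isStandardSmoothOfRelativeDimension_algebraMap]
  exact isStandardSmoothOfRelativeDimension_mvPolynomial k

/-- **`S_φ → Spec k` is smooth of relative dimension `#ι`** (open subscheme of the affine space `𝔸^ι`).
[cite: Hartshorne1977, III §10 Example 10.0.1] -/
theorem smoothOfRelativeDimension_baseSpz_hom :
    SmoothOfRelativeDimension (0 + Nat.card ι) (baseSpz k n d φ).hom := by
  haveI := smoothOfRelativeDimension_specSpzToSpec k (ι := ι)
  change SmoothOfRelativeDimension _ ((baseSpzOpens k n d φ).ι ≫ specSpzToSpec k)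
  infer_instance

/-- **`S_φ` is smooth over `k`.** [cite: Hartshorne1977, III §10 Example 10.0.1] -/
theorem smooth_baseSpz_hom : Smooth (baseSpz k n d φ).hom :=
  haveI := smoothOfRelativeDimension_baseSpz_hom k n d φ
  SmoothOfRelativeDimension.smooth (0 + Nat.card ι) _

/-- `S_φ → Spec k` is locally of finite type (it is smooth). [cite: Hartshorne1977, III §10 Example 10.0.1] -/
theorem locallyOfFiniteType_baseSpz_hom : LocallyOfFiniteType (baseSpz k n d φ).hom :=
  haveI := smooth_baseSpz_hom k n d φ
  inferInstance

omit [Finite ι] in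
/-- `S_φ` is separated over `k` (open in an affine scheme). [cite: Hartshorne1977, II Cor. 4.6] -/
theorem isSeparated_baseSpz_hom : IsSeparated (baseSpz k n d φ).hom := by
  change IsSeparated ((baseSpzOpens k n d φ).ι ≫ specSpzToSpec k)
  infer_instance

omit [Finite ι] in
/-- `𝔸^ι = Spec k[b]` is irreducible (`k[b]` is a domain). [cite: AtiyahMacdonald1969, Ch. 1 Ex. 19] -/
theorem irreducibleSpace_specMvPolynomial : IrreducibleSpace (Spec (CommRingCat.of (MvPolynomial ι k))) :=
  inferInstanceAs (IrreducibleSpace (PrimeSpectrum (MvPolynomial ι k)))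

omit [Finite ι] in
/-- **`S_φ` is irreducible as soon as it is non-empty** (a non-empty open subset of the irreducible affine
space `𝔸^ι`); for non-emptiness see `nonempty_algPoints_baseSpz_iff` and `irreducibleSpace_baseSpz_left_of_form`.
[cite: Hartshorne1977, I Example 1.1.3] -/
theorem irreducibleSpace_baseSpz_left (h : Nonempty (baseSpz k n d φ).left) :
    IrreducibleSpace (baseSpz k n d φ).left := by
  obtain ⟨x⟩ := h
  haveI := irreducibleSpace_specMvPolynomial k (ι := ι)
  change IrreducibleSpace (baseSpzOpens k n d φ)
  exact isIrreducible_iff_irreducibleSpace.mp ⟨⟨(baseSpzOpens k n d φ).ι x, by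
    rw [← Scheme.Opens.range_ι]; exact ⟨x, rfl⟩⟩,
    (PreirreducibleSpace.isPreirreducible_univ (X := Spec (CommRingCat.of (MvPolynomial ι k)))).open_subset
      (baseSpzOpens k n d φ).isOpen (Set.subset_univ _)⟩

omit [Finite ι] in
/-- A nonsingular form of the sub-family gives a point of the scheme `S_φ`, whence `S_φ` is irreducible.
[cite: Hartshorne1977, I Example 1.1.3] -/
theorem irreducibleSpace_baseSpz_left_of_form {G : MvPolynomial (Fin (n + 2)) k} (hG : G.IsHomogeneous d)
    (hJ : SmoothHypersurface.IsNonsingularForm k G) {ψ : MvPolynomial ι k →ₐ[k] k}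
    (hψ : ψ.comp φ = coeffHom k n d G) :
    IrreducibleSpace (baseSpz k n d φ).left :=
  irreducibleSpace_baseSpz_left k n d φ ⟨(pointOfFormSpz k n d φ hG hJ hψ).pt⟩

end Base


/-! ### §3 Over `ℂ`: quasi-projectivity and Ehresmann local triviality -/

section Complex

variable (n d : ℕ) {ι : Type} [Finite ι] (φ : CoeffRing ℂ n d →ₐ[ℂ] MvPolynomial ι ℂ)

/-- **`S_φ` is quasi-projective over `ℂ`**: an open subscheme of the affine space `𝔸^ι`, which is affine of
finite type hence quasi-projective (`IsQuasiProjectiveOver.of_isAffine`; Hartshorne II §4, p. 103).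
[cite: Hartshorne1977, II §4 Definition (quasi-projective), p. 103] -/
theorem isQuasiProjectiveOver_baseSpz : IsQuasiProjectiveOver (baseSpz ℂ n d φ) := by
  let A : SchemeOver ℂ := specOver ℂ (MvPolynomial ι ℂ)
  haveI : IsAffine A.left := inferInstanceAs (IsAffine (Spec _))
  haveI : LocallyOfFiniteType A.hom := by
    haveI := smoothOfRelativeDimension_specSpzToSpec ℂ (ι := ι)
    haveI : Smooth (specSpzToSpec ℂ (ι := ι)) := SmoothOfRelativeDimension.smooth (Nat.card ι) _
    change LocallyOfFiniteType (specSpzToSpec ℂ (ι := ι))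
    infer_instance
  obtain ⟨P, j, hP, hj⟩ := IsQuasiProjectiveOver.of_isAffine A
  let i : baseSpz ℂ n d φ ⟶ A := Over.homMk (baseSpzOpens ℂ n d φ).ι rfl
  haveI : IsOpenImmersion i.left := inferInstanceAs (IsOpenImmersion (baseSpzOpens ℂ n d φ).ι)
  haveI := hj
  refine ⟨P, i ≫ j, hP, ?_⟩
  rw [Over.comp_left]
  infer_instance

omit [Finite ι] in
/-- **The total space `𝒴_φ` is quasi-projective over `ℂ`** for `φ` surjective: `𝒴_φ ⟶ 𝒴_U` is a closed
immersion (`isClosedImmersion_totalSpzToTotal_left`) into the quasi-projective total space of the universal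
family (`isQuasiProjectiveOver_total`). [cite: Hartshorne1977, II §4 (p. 103) and Ex. 3.11] -/
theorem isQuasiProjectiveOver_totalSpz (hφ : Function.Surjective φ) : IsQuasiProjectiveOver (totalSpz ℂ n d φ) :=
  haveI := isClosedImmersion_totalSpzToTotal_left ℂ n d φ hφ
  IsQuasiProjectiveOver.of_isClosedImmersion (totalSpzToTotal ℂ n d φ) (isQuasiProjectiveOver_total ℂ n d)

/-- **Ehresmann for the specialised family**: for `n ≥ 1`, `d ≥ 1` the smooth projective family
`π_φ : 𝒴_φ → S_φ` over the smooth base `S_φ` is cohomologically locally trivial on all of `S_φ(ℂ)`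
(Voisin I, Thm. 9.3 and §9.2.1; the tree's `isCohomologicallyLocallyTrivialOn_univ_of_isSmoothProjectiveFamily_of_smooth`),
so the monodromy groups `ratMonodromyGroup (familySpz ℂ n d φ) k _ s` are defined at every point.
[cite: VoisinHodgeI2002, Thm. 9.3 and §9.2.1] -/
theorem isCohomologicallyLocallyTrivialOn_familySpz (hn : 1 ≤ n) (hd : 1 ≤ d) :
    IsCohomologicallyLocallyTrivialOn (familySpz ℂ n d φ) (Set.univ : Set (ComplexPoints (baseSpz ℂ n d φ))) :=
  haveI := smooth_baseSpz_hom ℂ n d φ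
  isCohomologicallyLocallyTrivialOn_univ_of_isSmoothProjectiveFamily_of_smooth (familySpz ℂ n d φ)
    (isSmoothProjectiveFamily_familySpz ℂ n d φ hn hd)

end Complex

end Literature.AlgebraicGeometry.HodgeTheory.UniversalHypersurface

end
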